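import Mathlib
import Literature.Computability.Complexity.CircuitClasses
import Literature.Computability.Complexity.ConstantDepth
import Literature.Computability.Complexity.CircuitLowerBounds
import Literature.Computability.MetaComplexity.MCSP
import Literature.Computability.MetaComplexity.FormulaModelsAE
import HarnessLib

/-!
# CHOPRS, HM Frontier D (`GapAND ∘ Formula` for `MCSP[2^{√n}]`): the magnification threshold D1
# and the known bound D4 IN THE SAME MODEL — as named facts (census row R8), with the class
# `GapAND_{c·N}-Formula[s]` typed

Source: L. Chen, S. Hirahara, I. C. Oliveira, J. Pich, N. Rajgopal, R. Santhanam, *Beyond natural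
proofs: hardness magnification and locality*, arXiv:1911.08297 (ITCS 2020 / J. ACM 2022) (bib key
`arXiv191108297`), §1.1 "HM Frontier D" (p. 4), §3.2.2 Thm 25 + Remark 26 (proof of D1), §5.1.4
Thm 47 (locality barrier D1^𝒪/D3^𝒪).

## The printed statements (verbatim, §1.1, p. 4)

* *"D1. MCSP[2^{√n}] ∉ GapAND_{O(N)}-Formula[N^{2.01}] ⇒ NQP ⊄ NC."*
* *"D4. MCSP[2^{√n}] ∉ GapAND_{O(N)}-Formula[N^{1.99}] ([CJW20], building on [HS17, OPS19])."*
* *"D. GapAND_N is the promise function on N bits such that it outputs 1 when all input bits are 1,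
  and outputs 0 when at most 1/10 of the input bits are 1. GapAND_{O(N)}-Formula[s] denotes circuits
  with GapAND_{O(N)} gate at the top with formulas of size s being inputs of the top gate. Therefore,
  GapAND_{O(N)}-Formula can be seen as randomized formulas with one-sided error. … The most
  interesting aspect of this magnification frontier is that the gap between the known hardness result
  and the magnification threshold is nearly-tight (N^{2−ε} versus N^{2+ε})."*

(D1 is proved in §3.2.2: Thm 25 for `GapAND_{O(N)}-Formula-XOR[N^ε]` and Remark 26, *"GapAND_{O(N)}-
Formula-XOR[N^ε] circuits are special cases of … GapAND_{O(N)}-Formula[N^{2+ε}] circuits. Therefore,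
the above proof implies both [C1] and [D1]"*; D4 is Chen–Jin–Williams' probabilistic-formula lower
bound, cf. `ChenJinWilliams2020.thm15_2` in this library, which is over two-sided-error distributions
and hence covers the one-sided `GapAND ∘ Formula` model.)

## Census value

Row R8 is a SAME-PROBLEM, SAME-MODEL pair: threshold `N^{2.01}` (D1) versus known `N^{1.99}` (D4) for
the language `MCSP[2^{√n}]` against `GapAND_{O(N)} ∘ Formula`. Both are typed below over ONE class,
`GapANDFORMULAae c s`, and one language, `sqrtMCSP`; the open statement between them is
`FrontierDHypothesis` (tagged hypothesis). CHOPRS Thm 47 (D1^𝒪: *"MCSP[2^{√n}] ∈ GapAND_{O(N)}-O_{N^{o(1)}}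
-Formula[N²]"*) is the locality barrier for this frontier (oracle formulas are not typed here).

## Rendering (each choice makes the typed facts WEAKER than or equal to the printed ones)

* `GapAND_{c·N}-Formula[s]`, a.e.: at every sufficiently large length `N` a list of `q` De Morgan
  formulas (`IsOver deMorganBasis`, `IsFormula`, leaf-size `≤ s N`, as in `FORMULAae`), `1 ≤ q ≤ c·N`,
  such that members of `L` are accepted by ALL of them and non-members by at most `q/10` of them
  (`10 · #accepting ≤ q`); nothing is required at small lengths. `GapAND_{O(N)}` = union over `c`
  (`q ≤ c'N + c'' ≤ (c'+c'')N` for `N ≥ 1`), so *"∉ GapAND_{O(N)}-Formula[s]"* is `∀ c, ∉`.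
  Constants in the source's formulas are absorbed (a De Morgan formula with constants is equivalent to
  one without constants with no more leaves, or is constant, and constant sub-formulas can be dropped /
  replaced by `x₀ ∧ ¬x₀` within the bounds), so the source's class at size `t` is contained in ours at
  size `⌈t⌉` (threshold D1: hypothesis rounded UP, `⌈N^{2.01}⌉`) and ours at size `⌊t⌋` is contained
  in the source's (known bound D4: rounded DOWN, `⌊N^{1.99}⌋`).
* `MCSP[2^{√n}]` ↦ `sqrtMCSP := MCSPSize (n ↦ ⌊2^{√n}⌋)` (tree convention: `B₂` gate count, as in
  the library's renderings of Frontiers A–C and of [CJW20]).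
* `NQP ⊄ NC` ↦ `¬ (NQP ⊆ NC1)`. In the LaTeX source of the paper (the held text) the symbol printed
  here as `NC` is the macro `\NC`, which denotes `NC¹`: §1.1 item A1 and Thm 14 are the same statement,
  spelled `\mathsf{NC}^1` in A1 and `\NC` in Thm 14; §3.3 is titled "`NP ⊄ NC¹` and Almost-Formula Lower
  Bounds" while its text says "`NP ⊄ \NC` would follow"; and the proofs of Thms 24/25 use the inclusion
  to obtain POLYNOMIAL-SIZE FORMULAS (*"NP ⊆ NC implies MCSP[…] ∈ Formula[N^{1+ε}]"*), which is the
  `NC¹` collapse. The tree's non-uniform `NC1 = NC 1` (every length, `B₂`, depth `c·log₂ n + c`,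
  polynomial size) is contained in the textbook non-uniform `NC¹`, so the printed conclusion implies
  ours. (An earlier version of this file rendered the conclusion as `¬ (NQP ⊆ ⋃ₖ NC k)`, which is
  STRONGER than what is printed — corrected here; census cell `pub-magnif`, finding F15.)
* HONEST FRAMING (census): `chop_frontierD1_ae` is a THRESHOLD fact (T), `chop_frontierD4_ae` a KNOWN
  bound (K); `FrontierDHypothesis` is the OPEN statement in between, recorded, not asserted. Nothing
  here is an approach to the summit.
-/

namespace Literature.Computability.MetaComplexity

open scoped ENNReal
open Filter Literature.Computability.Complexity

/-! ### The class `GapAND_{c·N} ∘ Formula[s]` (almost everywhere) -/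

/-- **`GapAND_{c·N}-Formula[s]`, almost-everywhere version** (CHOPRS §1.1, Frontier D): languages `L`
such that for all sufficiently large `N` there is a list of `q` De Morgan formulas on `N` inputs,
`1 ≤ q ≤ c·N`, each of leaf-size `≤ s N`, all of which accept every `x ∈ L` of length `N`, while at
most `q/10` of them accept any `x ∉ L` of length `N` (a top `GapAND_q` promise gate).
[cite: arXiv191108297, §1.1 (D: GapAND-Formula)] -/
def GapANDFORMULAae (c : ℕ) (s : ℕ → ℕ) : Set (Language Bool) :=
  {L | ∃ F : (N : ℕ) → List (Circuit (Fin N)), ∃ N₀ : ℕ,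
    (∀ N ≥ N₀, 1 ≤ (F N).length ∧ (F N).length ≤ c * N ∧
      ∀ D ∈ F N, D.IsOver deMorganBasis ∧ D.IsFormula ∧ D.leafSize ≤ s N) ∧
    ∀ x : List Bool, N₀ ≤ x.length →
      (x ∈ L → ∀ D ∈ F x.length, D.eval x.get = true) ∧
      (x ∉ L → 10 * (F x.length).countP (fun D => D.eval x.get) ≤ (F x.length).length)}

/-! ### The problem, the threshold, the known bound, the gap -/

/-- `MCSP[2^{√n}]`: truth tables (length `N = 2ⁿ`) of `n`-ary functions with a `B₂`-circuit of at
most `⌊2^{√n}⌋` gates. [cite: arXiv191108297, §1.1 (MCSP[2^{√n}])] -/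
noncomputable def sqrtMCSP : Language Bool :=
  MCSPSize fun n => ⌊(2 : ℝ) ^ Real.sqrt n⌋₊

/-- The threshold leaf-size `N^{2.01}` of D1, rounded up. [cite: arXiv191108297, §1.1 (D1)] -/
noncomputable def frontierDThreshold (N : ℕ) : ℕ := ⌈(N : ℝ) ^ (2.01 : ℝ)⌉₊

/-- The known leaf-size bound `N^{1.99}` of D4, rounded down. [cite: arXiv191108297, §1.1 (D4)] -/
noncomputable def frontierDKnown (N : ℕ) : ℕ := ⌊(N : ℝ) ^ (1.99 : ℝ)⌋₊

/-- **The hypothesis of D1** (census gap R8): `MCSP[2^{√n}] ∉ GapAND_{O(N)}-Formula[N^{2.01}]`, i.e.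
for every constant `c`, no a.e. `GapAND_{c·N} ∘ Formula[⌈N^{2.01}⌉]` family decides `sqrtMCSP`.
OPEN; recorded, not asserted. [cite: arXiv191108297, §1.1 (D1, hypothesis)] -/
def FrontierDHypothesis : Prop :=
  ∀ c : ℕ, sqrtMCSP ∉ GapANDFORMULAae c frontierDThreshold

/-- NAMED FACT (**CHOPRS §1.1, HM Frontier D, item D1**; proof: Thm 25 + Remark 26):
*"MCSP[2^{√n}] ∉ GapAND_{O(N)}-Formula[N^{2.01}] ⇒ NQP ⊄ NC"* (`NC` = the macro `\NC` = `NC¹`,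
module docstring). Users take `(h : chop_frontierD1_ae)`.
[cite: arXiv191108297, §1.1 (D1)] -/
def chop_frontierD1_ae : Prop :=
  FrontierDHypothesis → ¬ (NQP ⊆ NC1)

/-- NAMED FACT (**CHOPRS §1.1, HM Frontier D, item D4**, after Chen–Jin–Williams 2020, HS17, OPS19):
*"MCSP[2^{√n}] ∉ GapAND_{O(N)}-Formula[N^{1.99}]"* — for every constant `c`, no a.e.
`GapAND_{c·N} ∘ Formula[⌊N^{1.99}⌋]` family decides `sqrtMCSP`. Users take `(h : chop_frontierD4_ae)`.
[cite: arXiv191108297, §1.1 (D4)] -/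
def chop_frontierD4_ae : Prop :=
  ∀ c : ℕ, sqrtMCSP ∉ GapANDFORMULAae c frontierDKnown

/-- Consequence shape of D1. [cite: arXiv191108297, §1.1 (D1)] -/
theorem NQP_not_subset_NC1_of_frontierDHypothesis (h : chop_frontierD1_ae)
    (hyp : FrontierDHypothesis) : ¬ (NQP ⊆ NC1) :=
  h hyp

/-! ### API: sanity of the class -/

/-- `GapANDFORMULAae` is monotone in the fan-in constant and in the (eventual) leaf-size bound.
[folklore] -/
theorem GapANDFORMULAae_mono {c c' : ℕ} (hc : c ≤ c') {s s' : ℕ → ℕ}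
    (h : ∃ N₁ : ℕ, ∀ N ≥ N₁, s N ≤ s' N) : GapANDFORMULAae c s ⊆ GapANDFORMULAae c' s' := by
  rintro L ⟨F, N₀, hF, hx⟩
  obtain ⟨N₁, hN₁⟩ := h
  refine ⟨F, max N₀ N₁, fun N hN => ?_, fun x hxN => hx x (le_of_max_le_left hxN)⟩
  obtain ⟨h1, h2, h3⟩ := hF N (le_of_max_le_left hN)
  refine ⟨h1, h2.trans (Nat.mul_le_mul_right _ hc), fun D hD => ?_⟩
  obtain ⟨hB, hf, hs⟩ := h3 D hD
  exact ⟨hB, hf, hs.trans (hN₁ N (le_of_max_le_right hN))⟩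

/-- In particular the known-bound class is (eventually) inside the threshold class:
`GapAND_{c·N}-Formula[⌊N^{1.99}⌋] ⊆ GapAND_{c·N}-Formula[⌈N^{2.01}⌉]` — the census gap of row R8 is a
genuine interval in ONE model. [folklore] -/
theorem GapANDFORMULAae_known_subset_threshold (c : ℕ) :
    GapANDFORMULAae c frontierDKnown ⊆ GapANDFORMULAae c frontierDThreshold := by
  refine GapANDFORMULAae_mono le_rfl ⟨1, fun N hN => ?_⟩
  unfold frontierDKnown frontierDThreshold
  have hN' : (1 : ℝ) ≤ N := by exact_mod_cast hN
  exact (Nat.floor_le_ceil _).trans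
    (Nat.ceil_mono (Real.rpow_le_rpow_of_exponent_le hN' (by norm_num)))

/-- Hence the threshold hypothesis implies the known bound's statement (`T ⇒ K` direction of the census:
the hypothesis is at least as strong as what is known). [folklore] -/
theorem frontierDHypothesis_implies_known (h : FrontierDHypothesis) :
    ∀ c : ℕ, sqrtMCSP ∉ GapANDFORMULAae c frontierDKnown :=
  fun c hmem => h c (GapANDFORMULAae_known_subset_threshold c hmem)

/-- **A single formula is a `GapAND₁ ∘ Formula` circuit**: `FORMULAae s ⊆ GapANDFORMULAae c s` for
`c ≥ 1` (the one-element list; a rejected input is accepted by `0 ≤ 1/10` of the sub-formulas).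
[folklore] -/
theorem FORMULAae_subset_GapANDFORMULAae {c : ℕ} (hc : 1 ≤ c) (s : ℕ → ℕ) :
    FORMULAae s ⊆ GapANDFORMULAae c s := by
  rintro L ⟨C, ⟨N₀, hN₀⟩, hdec⟩
  refine ⟨fun N => [C N], max N₀ 1, fun N hN => ⟨le_rfl, ?_, fun D hD => ?_⟩, fun x hxN => ⟨?_, ?_⟩⟩
  · simpa using Nat.mul_le_mul hc (le_of_max_le_right hN)
  · rw [List.mem_singleton] at hD
    subst hD
    exact hN₀ N (le_of_max_le_left hN)
  · intro hx D hD
    rw [List.mem_singleton] at hD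
    subst hD
    rw [hdec x]
    exact (Set.mem_iff_boolIndicator _ _).1 hx
  · intro hx
    have hfalse : (C x.length).eval x.get = false := by
      rw [hdec x]
      exact (Set.notMem_iff_boolIndicator _ _).1 hx
    simp [hfalse]

/-- **The Frontier-D classes are inhabited** (`headLang`, one leaf): both `GapAND_{c·N}-Formula[⌊N^{1.99}⌋]`
and `GapAND_{c·N}-Formula[⌈N^{2.01}⌉]` contain a nontrivial language for every `c ≥ 1`, so
`chop_frontierD4_ae` and `FrontierDHypothesis` are genuine lower-bound statements. [folklore] -/
theorem headLang_mem_GapANDFORMULAae_known {c : ℕ} (hc : 1 ≤ c) :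
    headLang ∈ GapANDFORMULAae c frontierDKnown := by
  refine FORMULAae_subset_GapANDFORMULAae hc _ (headLang_mem_FORMULAae ⟨1, fun N hN => ?_⟩)
  unfold frontierDKnown
  have hN' : (1 : ℝ) ≤ N := by exact_mod_cast hN
  rw [Nat.one_le_floor_iff]
  exact Real.one_le_rpow hN' (by norm_num)

/-- See `headLang_mem_GapANDFORMULAae_known`. [folklore] -/
theorem headLang_mem_GapANDFORMULAae_threshold {c : ℕ} (hc : 1 ≤ c) :
    headLang ∈ GapANDFORMULAae c frontierDThreshold :=
  GapANDFORMULAae_known_subset_threshold c (headLang_mem_GapANDFORMULAae_known hc)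

end Literature.Computability.MetaComplexity
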